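import Literature.MathematicalPhysics.QuantumFieldTheory.Balaban1983to89.Node00.Record5C
import Literature.MathematicalPhysics.QuantumFieldTheory.Balaban1983to89.B9LeafUnpinnedRecord5

/-!
# `Balaban1983to89.B9LeafUnpinnedRecord5C` — DAG node N06 · [Balaban1985BackgroundPropagators] at THE RECORD PREDICATE OF RECORD `Node00.IsRecordOfRecord₅C`
# (C-binding; pub-ymgap chair R434): the [B9] bundle is still the free residual field `Residual₅.Y`, so — exactly as over `IsRecordOfRecord₅` (`…B9LeafUnpinnedRecord5`) —
# N06 is UNDETERMINED over the ₅C records; no `stub_N06` over ₅C; the Stage-3′(Y) pin is required (kernel twin of the «verbatim for ₅C» sentence of the ₅ module)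

B9 = T. Bałaban, *Propagators for lattice gauge theories in a background field*, Commun. Math. Phys. **99** (1985) 389–434 [Balaban1985BackgroundPropagators].  The record
predicate is NODE 00's `Node00.Record5C` (seat pub-ymgap-node00-def g28): `upOfRecord₅C θ P = withB10 (upOfRecord₅ θ P) (b10Compact …)` re-binds ONLY `b10`
(`upOfRecord₅C_leaves`: the other eleven leaves are the N-binding's, `rfl`), so a Stage-5 record of `Record5` re-bound by the C-binding is a ₅C record with the SAME `b9` leaf
(`isRecordOfRecord₅C_rebind_of_isRecordOfRecord₅`).

YM-PLAN Track A, node N06; seat `pub-ymgap-dag-n06-a` (g2).  THEOREMS ONLY (0 `def`, 0 `sorry`, standard axioms).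
* §0 `exists_isRecordOfRecord₅C_b9_iff` — every bundle `Y` occurs at some ₅C record with `(leavesP w P).b9 ↔ B9LeafX Y` at every run (from the ₅ statement by re-binding).
* §1 `exists_isRecordOfRecord₅C_b6_main_imp_not_b9_main`, `not_b6_and_b9_main_over_record₅C`, `not_b9_main_over_record₅C_of_b6_main` (negative side; `b4`, `b5`, `b7` at every
  ₅C record by `Node00.b4∕b5∕b7_main_of_isRecordOfRecord₅C`).
* §2 `exists_isRecordOfRecord₅C_b9_main` (positive side, the zero-operator bundle).  §3 `b9_main_undetermined_over_record₅C`.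
* §4 `b9_main_undetermined_of_free` — the TEMPLATE for every later record predicate (the rev-1 regression shape a Stage-3′(Y) predicate must FAIL: «every bundle occurs»
  + b4∕b5∕b7 forced ⇒ N06 undetermined); `b9_main_undetermined_over_record₅C'` — ₅C as an instance.
HONEST FRAMING: count-neutral; N06 NOT discharged; nothing asserted about [B9] at Bałaban's objects; finite T⁴ at fixed ε; nothing continuum ∕ ℝ⁴ ∕ OS ∕ mass-gap ∕ Clay.
-/

noncomputable section

namespace Literature.MathematicalPhysics.QuantumFieldTheory.Balaban1983to89.B9LeafUnpinnedRecord5C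

open DagBinding DagDischargedII

variable (F : T4Continuum.T4Family) (N : ℕ) [NeZero N]

/-! ## §0 Every [B9] bundle occurs at some ₅C record -/

/-- **Every [B9] bundle occurs at some record of `IsRecordOfRecord₅C`**: the ₅ record of `B9LeafUnpinnedRecord5.exists_isRecordOfRecord₅_b9_iff` re-bound by the C-binding
(`Node00.isRecordOfRecord₅C_rebind_of_isRecordOfRecord₅`); the `b9` leaf is untouched by the re-binding (`Node00.upOfRecord₅C_leaves`).
[cite: Balaban1985BackgroundPropagators, Thms 3.1–3.15 pp.397–432 (bookkeeping over NODE 00's record predicate of record)] -/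
theorem exists_isRecordOfRecord₅C_b9_iff (Y : PrintedCarriers9X) :
    ∃ (D : T4Continuum.FiniteEpsData F (Node00.SU N)) (w : WorldP), Node00.IsRecordOfRecord₅C F N D w ∧
      ∀ P : B12.RunParams, ((leavesP w P).b9 ↔ B9LeafX Y) := by
  obtain ⟨D, w, hrec, hb9⟩ := B9LeafUnpinnedRecord5.exists_isRecordOfRecord₅_b9_iff F N Y
  obtain ⟨θ, -, hup, hrecC⟩ := Node00.isRecordOfRecord₅C_rebind_of_isRecordOfRecord₅ hrec
  refine ⟨D, { w with up := Node00.upOfRecord₅C F N θ }, hrecC, fun P => ?_⟩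
  have e : (leavesP { w with up := Node00.upOfRecord₅C F N θ } P).b9 = (leavesP w P).b9 := by
    show (Node00.upOfRecord₅C F N θ P).b9 = (w.up P).b9
    rw [hup P]
    exact (Node00.upOfRecord₅C_leaves F N θ P).2.2.2.2.2.1
  rw [e]
  exact hb9 P

/-! ## §1 Given N03's antecedents, N06 FAILS at some ₅C record -/

/-- **At some ₅C record, N03 implies `¬` N06 for every run** (the refuting bundle of `B9LeafUnpinned.exists_not_b9LeafX`; `b4`, `b5`, `b7` hold at every ₅C record).
[cite: Balaban1985BackgroundPropagators, Thm 3.1 (3.42) p.397 (bookkeeping: the typed statement over a degenerate bundle at a ₅C record)] -/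
theorem exists_isRecordOfRecord₅C_b6_main_imp_not_b9_main :
    ∃ (D : T4Continuum.FiniteEpsData F (Node00.SU N)) (w : WorldP), Node00.IsRecordOfRecord₅C F N D w ∧
      ∀ P : B12.RunParams, Dag.B6_main (leavesP w P) → ¬ Dag.B9_main (leavesP w P) := by
  obtain ⟨Y, -, hY⟩ := B9LeafUnpinned.exists_not_b9LeafX
  obtain ⟨D, w, hrec, hb9⟩ := exists_isRecordOfRecord₅C_b9_iff F N Y
  refine ⟨D, w, hrec, fun P h6 h9 => hY ?_⟩
  have h4 : (leavesP w P).b4 := Node00.b4_main_of_isRecordOfRecord₅C hrec P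
  have h5 : (leavesP w P).b5 := Node00.b5_main_of_isRecordOfRecord₅C hrec P h4
  have h7 : (leavesP w P).b7 := Node00.b7_main_of_isRecordOfRecord₅C hrec P h5
  exact (hb9 P).1 (h9 h4 h5 (h6 h4 h5) h7)

/-- Hence the ₅C record predicate cannot carry N03 ∧ N06 at all its records. [cite: Balaban1985BackgroundPropagators, Thms 3.1–3.15 pp.397–432 (bookkeeping)] -/
theorem not_b6_and_b9_main_over_record₅C :
    ¬ ∀ (D : T4Continuum.FiniteEpsData F (Node00.SU N)) (w : WorldP), Node00.IsRecordOfRecord₅C F N D w →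
      ∀ P : B12.RunParams, Dag.B6_main (leavesP w P) ∧ Dag.B9_main (leavesP w P) := by
  obtain ⟨D, w, hrec, h⟩ := exists_isRecordOfRecord₅C_b6_main_imp_not_b9_main F N
  exact fun hall => h ⟨0, 0, 0⟩ (hall D w hrec ⟨0, 0, 0⟩).1 (hall D w hrec ⟨0, 0, 0⟩).2

/-- Were N03 closed over the ₅C records, N06 would be REFUTABLE over them. [cite: Balaban1985BackgroundPropagators, Thms 3.1–3.15 pp.397–432 (bookkeeping)] -/
theorem not_b9_main_over_record₅C_of_b6_main
    (h6 : ∀ (D : T4Continuum.FiniteEpsData F (Node00.SU N)) (w : WorldP), Node00.IsRecordOfRecord₅C F N D w →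
      ∀ P : B12.RunParams, Dag.B6_main (leavesP w P)) :
    ¬ ∀ (D : T4Continuum.FiniteEpsData F (Node00.SU N)) (w : WorldP), Node00.IsRecordOfRecord₅C F N D w →
      ∀ P : B12.RunParams, Dag.B9_main (leavesP w P) := by
  obtain ⟨D, w, hrec, h⟩ := exists_isRecordOfRecord₅C_b6_main_imp_not_b9_main F N
  exact fun hall => h ⟨0, 0, 0⟩ (h6 D w hrec ⟨0, 0, 0⟩) (hall D w hrec ⟨0, 0, 0⟩)

/-! ## §2 N06 HOLDS at some ₅C record -/

/-- **At some ₅C record, `b9` — hence N06 — holds at every run** (the zero-operator bundle of `B9LeafKnitNonVacuity.exists_b9LeafX_of_vanishing_operators`).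
[cite: Balaban1985BackgroundPropagators, Thms 3.1–3.15 pp.397–432 (bookkeeping: the typed leaf over a degenerate bundle at a ₅C record)] -/
theorem exists_isRecordOfRecord₅C_b9_main :
    ∃ (D : T4Continuum.FiniteEpsData F (Node00.SU N)) (w : WorldP), Node00.IsRecordOfRecord₅C F N D w ∧
      ∀ P : B12.RunParams, (leavesP w P).b9 ∧ Dag.B9_main (leavesP w P) := by
  obtain ⟨Y, -, -, -, hY⟩ := B9LeafKnitNonVacuity.exists_b9LeafX_of_vanishing_operators
  obtain ⟨D, w, hrec, hb9⟩ := exists_isRecordOfRecord₅C_b9_iff F N Y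
  exact ⟨D, w, hrec, fun P => ⟨(hb9 P).2 hY, B9LeafKnit.b9_main_of_b9 ((hb9 P).2 hY)⟩⟩

/-! ## §3 N06 is undetermined over the record predicate of record -/

/-- **N06 is UNDETERMINED over `IsRecordOfRecord₅C`**: it holds at every run of one ₅C record and fails (given N03's antecedents) at every run of another; `stub_N06` must
be typed over a stage PINNING the [B9] bundle (node00-def's «Stage 3′(Y)»; knit seat's `B9-PIN-DESIGN-g2.md`). [cite: Balaban1985BackgroundPropagators, Thms 3.1–3.15 pp.397–432 (bookkeeping: independence over the record predicate of record)] -/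
theorem b9_main_undetermined_over_record₅C :
    (∃ (D : T4Continuum.FiniteEpsData F (Node00.SU N)) (w : WorldP), Node00.IsRecordOfRecord₅C F N D w ∧
      ∀ P : B12.RunParams, Dag.B9_main (leavesP w P)) ∧
    (∃ (D : T4Continuum.FiniteEpsData F (Node00.SU N)) (w : WorldP), Node00.IsRecordOfRecord₅C F N D w ∧
      ∀ P : B12.RunParams, Dag.B6_main (leavesP w P) → ¬ Dag.B9_main (leavesP w P)) := by
  obtain ⟨D, w, hrec, h⟩ := exists_isRecordOfRecord₅C_b9_main F N
  exact ⟨⟨D, w, hrec, fun P => (h P).2⟩, exists_isRecordOfRecord₅C_b6_main_imp_not_b9_main F N⟩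

/-! ## §4 Template for later stages (rev-1 regression shape) -/

/-- **TEMPLATE for every later record predicate** (₆, ₇C, ₈, … and the test a Stage-3′(Y) predicate must FAIL): if a predicate `Rec` on (datum, world) pairs
(i) lets every [B9] bundle occur — `∀ Y, ∃ D w, Rec D w ∧ ∀ P, (leavesP w P).b9 ↔ B9LeafX Y` — and (ii) forces `b4`, `b4 → b5`, `b5 → b7` at every run, then N06 is
UNDETERMINED over `Rec` (true at every run of one record, false given N03's antecedents at another).  A stage PINS [B9] exactly when (i) fails for it.
[cite: Balaban1985BackgroundPropagators, Thms 3.1–3.15 pp.397–432 (bookkeeping: independence template over record predicates)] -/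
theorem b9_main_undetermined_of_free {α : Type*} (Rec : α → WorldP → Prop)
    (hfree : ∀ Y : PrintedCarriers9X, ∃ (D : α) (w : WorldP), Rec D w ∧ ∀ P : B12.RunParams, ((leavesP w P).b9 ↔ B9LeafX Y))
    (h4 : ∀ D w, Rec D w → ∀ P : B12.RunParams, Dag.B4_main (leavesP w P))
    (h5 : ∀ D w, Rec D w → ∀ P : B12.RunParams, Dag.B5_main (leavesP w P))
    (h7 : ∀ D w, Rec D w → ∀ P : B12.RunParams, Dag.B7_main (leavesP w P)) :
    (∃ (D : α) (w : WorldP), Rec D w ∧ ∀ P : B12.RunParams, Dag.B9_main (leavesP w P)) ∧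
    (∃ (D : α) (w : WorldP), Rec D w ∧ ∀ P : B12.RunParams, Dag.B6_main (leavesP w P) → ¬ Dag.B9_main (leavesP w P)) := by
  constructor
  · obtain ⟨Y, -, -, -, hY⟩ := B9LeafKnitNonVacuity.exists_b9LeafX_of_vanishing_operators
    obtain ⟨D, w, hrec, hb9⟩ := hfree Y
    exact ⟨D, w, hrec, fun P => B9LeafKnit.b9_main_of_b9 ((hb9 P).2 hY)⟩
  · obtain ⟨Y, -, hY⟩ := B9LeafUnpinned.exists_not_b9LeafX
    obtain ⟨D, w, hrec, hb9⟩ := hfree Y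
    refine ⟨D, w, hrec, fun P h6 h9 => hY ?_⟩
    have hb4 : (leavesP w P).b4 := h4 D w hrec P
    have hb5 : (leavesP w P).b5 := h5 D w hrec P hb4
    have hb7 : (leavesP w P).b7 := h7 D w hrec P hb5
    exact (hb9 P).1 (h9 hb4 hb5 (h6 hb4 hb5) hb7)

/-- The ₅C result as an instance of the template (cross-check). [cite: Balaban1985BackgroundPropagators, Thms 3.1–3.15 pp.397–432 (bookkeeping)] -/
theorem b9_main_undetermined_over_record₅C' :
    (∃ (D : T4Continuum.FiniteEpsData F (Node00.SU N)) (w : WorldP), Node00.IsRecordOfRecord₅C F N D w ∧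
      ∀ P : B12.RunParams, Dag.B9_main (leavesP w P)) ∧
    (∃ (D : T4Continuum.FiniteEpsData F (Node00.SU N)) (w : WorldP), Node00.IsRecordOfRecord₅C F N D w ∧
      ∀ P : B12.RunParams, Dag.B6_main (leavesP w P) → ¬ Dag.B9_main (leavesP w P)) :=
  b9_main_undetermined_of_free (Node00.IsRecordOfRecord₅C F N) (exists_isRecordOfRecord₅C_b9_iff F N)
    (fun _ _ h P => Node00.b4_main_of_isRecordOfRecord₅C h P) (fun _ _ h P => Node00.b5_main_of_isRecordOfRecord₅C h P)
    (fun _ _ h P => Node00.b7_main_of_isRecordOfRecord₅C h P)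

end Literature.MathematicalPhysics.QuantumFieldTheory.Balaban1983to89.B9LeafUnpinnedRecord5C

end
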